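import Summits.MatrixMultiplication.MatrixMultiplication.Theorems.FarEdgeDescentSupportStratumDoor
import Summits.MatrixMultiplication.MatrixMultiplication.Theorems.FarEdgeDescentStratumTightConcise
import HarnessLib

/-!
# Verdict on the same-support stratum of `⟨2,2,2⟩`: flat ⟺ (`ω = 2` ∧ spectral twin), and the twin question sits exactly on the asymptotic rank conjecture

Route `FarEdgeDescent` (cell `decomp-mm`, lens 2 «structural dichotomy (special vs generic)»,
gen 33), Kernel VIII-d; support for the aside `SubLogRate` (stmt-MatrixMultiplication-25371).
Joins the three kernels of this generation on the weighted stars `𝔖^w` (`w` nowhere zero — the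
generic members of the stratum `supp = supp ⟨2,2,2⟩`; `w ≡ 1` is the special member `≅ ⟨2,2,2⟩`):

* the s-rank DOOR (`FarEdgeDescentSupportStratumDoor`): `R̃(𝔖^w) ≤ 4 ⟹ ω = 2`;
* the PIN (`FarEdgeDescentStratumPinning`): `Q̃(𝔖^w) = 4`, every universal spectral point reads
  `≥ 4`, and under `ω = 2` twin `⟺` flat;
* TIGHT ∧ CONCISE (`FarEdgeDescentStratumTightConcise`): ARC `⟹ R̃(𝔖^w) = 4` and twin.

Main statements:

* `flat_iff_summit_and_twin` — **`R̃(𝔖^w) = 4 ⟺ (ω = 2 ∧ 𝔖^w` is a spectral twin of `⟨2,2,2⟩)`**: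
  flatness of ONE generic member is exactly the summit plus the twin property of that member;
* `summit_and_twins_of_arc` — ARC delivers both conjuncts on the whole stratum;
* `twin_verdict` — for every member and every universal spectral point: twin, or else ARC fails
  and (the member has excess `R̃ > 4` or `ω > 2`);
* `not_summit_iff_forall_excess`, restated next to the twin property: `ω > 2 ⟺` every member has
  `R̃ > 4` — in which case no member's twin property is decided by these kernels.

References: H. Cohn, C. Umans, *Fast matrix multiplication using coherent configurations*, SODA
2013, §3, Prop. 5, Thm. 6 [CohnUmans2013]; A. Conner, F. Gesmundo, J.M. Landsberg, E. Ventura,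
Y. Wang, Collect. Math. 72 (2021), Conj. 1.4 [ConnerGesmundoLandsbergVenturaWang2020];
M. Christandl, P. Vrana, J. Zuiddam, J. AMS 36 (2023), Prop. 1.6 [ChristandlVranaZuiddam2023].
-/

noncomputable section

open scoped BigOperators

set_option linter.dupNamespace false

namespace Summit.MatrixMultiplication.MatrixMultiplication.Theorems.FarEdgeDescentStratumPinning

open Literature.Computability.AlgebraicComplexity
open Summit.MatrixMultiplication.MatrixMultiplication.Theorems.FarEdgeDescentSignTwist
open Summit.MatrixMultiplication.MatrixMultiplication.Theorems.FarEdgeDescentSignStarSRank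
open Summit.MatrixMultiplication.MatrixMultiplication.Theorems.FarEdgeDescentSupportStratumDoor
  (summit_of_asymptoticRank_weightedStar_le_four four_lt_asymptoticRank_weightedStar_of_not_summit
    not_summit_iff_forall_four_lt)

/-- **Flat ⟺ (summit ∧ twin).** For a nowhere-zero weight table `w`:
`R̃(𝔖^w) = 4` iff `ω = 2` AND every universal spectral point reads the same on `𝔖^w` and on
`⟨2,2,2⟩` (`⟹`: the s-rank door gives `ω = 2`, then `4 ≤ F ≤ R̃ = 4` on both; `⟸`: Kernel VIII-b).
[cite: CohnUmans2013, Thm. 6] -/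
theorem flat_iff_summit_and_twin {w : Mid → ℂ} (hw : ∀ b, w b ≠ 0) :
    asymptoticRank (weightedStar ℂ 2 1 w) = 4 ↔
      (_root_.MatrixMultiplication ∧
        ∀ F, IsUniversalSpectralPoint ℂ F → F (weightedStar ℂ 2 1 w) = F (matMulTensor ℂ 2 2 2)) := by
  constructor
  · intro h
    have hS : _root_.MatrixMultiplication := summit_of_asymptoticRank_weightedStar_le_four hw h.le
    exact ⟨hS, (twin_iff_flat_of_summit hS _ (fun F hF => four_le_spectralPoint_weightedStar hw hF)).2 h⟩
  · rintro ⟨hS, htwin⟩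
    exact (twin_iff_flat_of_summit hS _ (fun F hF => four_le_spectralPoint_weightedStar hw hF)).1 htwin

/-- **A flat generic member would settle everything**: `R̃(𝔖^w) ≤ 4` for one nowhere-zero `w` gives
`ω = 2` and makes that member a spectral twin of `⟨2,2,2⟩`. [cite: CohnUmans2013, Thm. 6] -/
theorem summit_and_twin_of_flat {w : Mid → ℂ} (hw : ∀ b, w b ≠ 0)
    (h : asymptoticRank (weightedStar ℂ 2 1 w) ≤ 4) :
    _root_.MatrixMultiplication ∧
      ∀ F, IsUniversalSpectralPoint ℂ F → F (weightedStar ℂ 2 1 w) = F (matMulTensor ℂ 2 2 2) :=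
  (flat_iff_summit_and_twin hw).1 (le_antisymm h (four_le_asymptoticRank_weightedStar hw))

/-- **ARC delivers both conjuncts**: `ω = 2` and the twin property of every member. [cite: ConnerGesmundoLandsbergVenturaWang2020, Conj. 1.4] -/
theorem summit_and_twins_of_arc (hARC : StrassenAsymptoticRankConjecture) {w : Mid → ℂ}
    (hw : ∀ b, w b ≠ 0) :
    _root_.MatrixMultiplication ∧
      ∀ F, IsUniversalSpectralPoint ℂ F →
        F (weightedStar ℂ 2 1 w) = F (matMulTensor ℂ 2 2 2) ∧
          F (weightedTStar ℂ 2 1 w) = F (matMulTensor ℂ 2 2 2) :=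
  ⟨(flat_iff_summit_and_twin hw).1 (asymptoticRank_weightedStar_of_arc hARC hw) |>.1,
    fun _ hF => stratum_twins_of_arc hARC hw hF⟩

/-- **`ω > 2 ⟺` every generic member has excess `R̃(𝔖^w) > 4`** (Kernel VIII-a), placed next to the
twin property: in that world flatness fails everywhere on the stratum and ARC fails at every member.
[cite: ConnerGesmundoLandsbergVenturaWang2020, Conj. 1.4] -/
theorem not_summit_iff_forall_excess :
    ¬ _root_.MatrixMultiplication ↔
      ∀ w : Mid → ℂ, (∀ b, w b ≠ 0) → 4 < asymptoticRank (weightedStar ℂ 2 1 w) :=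
  not_summit_iff_forall_four_lt

/-- `ω > 2` refutes ARC already at the special member `𝔖^1 ≅ ⟨2,2,2⟩` (and at every member). [cite: ConnerGesmundoLandsbergVenturaWang2020, Conj. 1.4] -/
theorem not_arc_of_not_summit (hS : ¬ _root_.MatrixMultiplication) :
    ¬ StrassenAsymptoticRankConjecture :=
  not_arc_of_four_lt_asymptoticRank_weightedStar (fun _ => one_ne_zero)
    (four_lt_asymptoticRank_weightedStar_of_not_summit hS (fun _ => one_ne_zero))

/-- **The twin verdict.** For every nowhere-zero `w` and every universal spectral point `F`, exactly
one of: `F` reads the same on `𝔖^w` and `⟨2,2,2⟩`; or `F` separates them — and then ARC fails, and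
either this member has excess `R̃(𝔖^w) > 4` (with `F(𝔖^w) > 4 = F⟨2,2,2⟩`) or `ω > 2`.
[cite: ConnerGesmundoLandsbergVenturaWang2020, Conj. 1.4] -/
theorem twin_verdict {w : Mid → ℂ} (hw : ∀ b, w b ≠ 0) {F : SpectralMap ℂ}
    (hF : IsUniversalSpectralPoint ℂ F) :
    F (weightedStar ℂ 2 1 w) = F (matMulTensor ℂ 2 2 2) ∨
      (¬ StrassenAsymptoticRankConjecture ∧
        (4 < asymptoticRank (weightedStar ℂ 2 1 w) ∨ ¬ _root_.MatrixMultiplication)) := by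
  by_cases h : F (weightedStar ℂ 2 1 w) = F (matMulTensor ℂ 2 2 2)
  · exact Or.inl h
  · exact Or.inr ⟨not_arc_of_separation_from_matMul hw hF h, separation_from_matMul _
      (fun F hF => four_le_spectralPoint_weightedStar hw hF) hF h⟩

/-- The transposed members: separation of `𝔖^{wᵀ}` from `⟨2,2,2⟩` refutes ARC and forces excess at
`𝔖^{wᵀ}` or `ω > 2` (no s-rank door is claimed for `𝔖^{wᵀ}`, whose support is not that of `⟨2,2,2⟩`).
[cite: ConnerGesmundoLandsbergVenturaWang2020, Conj. 1.4] -/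
theorem ttwin_verdict {w : Mid → ℂ} (hw : ∀ b, w b ≠ 0) {F : SpectralMap ℂ}
    (hF : IsUniversalSpectralPoint ℂ F) :
    F (weightedTStar ℂ 2 1 w) = F (matMulTensor ℂ 2 2 2) ∨
      (¬ StrassenAsymptoticRankConjecture ∧
        (4 < asymptoticRank (weightedTStar ℂ 2 1 w) ∨ ¬ _root_.MatrixMultiplication)) := by
  by_cases h : F (weightedTStar ℂ 2 1 w) = F (matMulTensor ℂ 2 2 2)
  · exact Or.inl h
  · exact Or.inr ⟨not_arc_of_tseparation_from_matMul hw hF h, separation_from_matMul _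
      (fun F hF => four_le_spectralPoint_weightedTStar hw hF) hF h⟩

end Summit.MatrixMultiplication.MatrixMultiplication.Theorems.FarEdgeDescentStratumPinning

end
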